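import Summits.Ventures.PercRepro.RankLevelSetLevelFiveSharpT
import Summits.Ventures.PercRepro.S2SharpCoreST
import Summits.Ventures.PercRepro.S2SharpCoreMid
import Summits.Ventures.PercRepro.S2MidFlatsEight
import Summits.Ventures.PercRepro.S2CellsP24ST
import Summits.Ventures.PercRepro.S2TailP24ST
import Summits.Ventures.PercRepro.S2CellsP24M
import Summits.Ventures.PercRepro.S2CoreTwentyFour

/-!
# PercRepro — THEOREM C₅ AT `25`: THE SET-INDEXED COUNT, LEMMA T′ AND THE MID FLATS AT CORANK `8` (p7, gen 3; S2)

THEOREM C₅ AT `26` one step further. At `p = 24` the cells `(24, d)`, `6 ≤ d ≤ 25`, `d ≠ 8`, close with the free slack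
on the level count INDEXED BY SPANNING SETS (S2SetCountQ: the giant term is `(σ_g − σ_m)·C(F_max, 6)`) with LEMMA T′ —
S2CellsP24ST / S2TailP24ST on the core `c025_core_five_sharp_cell_st`; the cell `(24, 8)` closes with the MID class
explicit (S2SetCountMid), its mid spanning sets being at most `91·C(12, 6)` (S2MidFlatsEight: at corank `8` every
mid closure is a `12`-subset of the `14`-point union of two of them) — S2CellsP24M on `c025_core_five_sharp_cell_mid`;
the coranks `≥ 26` at `p = 24` close by the sum key from `n₀ = 50` (S2CoreTwentyFour). Hence:

* **`c025_core_five_twentyfour`** — the `e`-free core at level `5`, rank `24`, every corank `6 ≤ d ≤ 25`;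
* **`c025_five_of_four_sharp_st_from`** — for `P ≥ 24`, level `4` for all `p ≥ P` implies level `5` for all `p ≥ P + 1`;
* **`c025_five_large_sharp25`** — UNCONDITIONAL over the landed tree: C-025 at level `5` for every `p ≥ 25` (level `4`
  from S1's `c025_four_seventeen`); `c025_five_large_sharp25'` is the `C025` spelling.
Axioms: standard.
-/

open scoped Matroid

namespace PercRepro

namespace S2

/-- **The `p = 24` cells, dispatched**: for every corank `6 ≤ d ≤ 25` some slack `m ≤ 1024` with
`1024·U′(24, d) ≤ (1024 − m)·2^(d−5)·C(29, 5)` and `1024·T′(24 + d, d) ≤ m·2^(24+d)`. -/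
theorem cellsP24ST (d : ℕ) (hd6 : 6 ≤ d) (hd25 : d ≤ 25) (hd8 : d ≠ 8) :
    ∃ m : ℕ, m ≤ 1024 ∧
      (1024 * (((24 + d).choose 5 : ℚ) +
      (∑ j ∈ Finset.range (d - 5), (Nat.choose (min 13 ((d + 6) / 2 + 1 - 2)) j : ℚ) / (((j + 1) + 3 * (j + 1).choose 2 : ℕ) : ℚ)) *
        (((1 + d * (d - 1) / 2) * (24 + d - 3).choose 3 + d * (d + 1) * (d + 2) / 3 * (24 + d - 4).choose 2 + (d + 4).choose 5 * (24 + d - 5) + (d + 5).choose 6 : ℕ) : ℚ) +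
      ((∑ j ∈ Finset.range (d - 5), (Nat.choose (min 19 (5 + d) - 6) j : ℚ) / (((j + 1) + 3 * (j + 1).choose 2 : ℕ) : ℚ)) -
        (∑ j ∈ Finset.range (d - 5), (Nat.choose (min 13 ((d + 6) / 2 + 1 - 2)) j : ℚ) / (((j + 1) + 3 * (j + 1).choose 2 : ℕ) : ℚ))) *
        ((min 19 (5 + d)).choose 6 : ℚ)) ≤
        ((1024 - m : ℕ) : ℚ) * 2 ^ (d - 5) * ((24 + 5).choose 5 : ℚ)) ∧
      (1024 * ((((24 + d).choose 4 * 2 ^ 6 + (24 + d).choose 3 * 2 ^ 3 + (24 + d).choose 2 * 2 + (24 + d) + 1 : ℕ) : ℚ) +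
      (((24 + d).choose 5 : ℚ) + (∑ j ∈ Finset.range (d), (Nat.choose (min 13 ((d + 6) / 2 + 1 - 2)) j : ℚ) / (((j + 1) + 3 * (j + 1).choose 2 : ℕ) : ℚ)) * (((1 + d * (d - 1) / 2) * (24 + d - 3).choose 3 + d * (d + 1) * (d + 2) / 3 * (24 + d - 4).choose 2 + (d + 4).choose 5 * (24 + d - 5) + (d + 5).choose 6 : ℕ) : ℚ) +
        ((∑ j ∈ Finset.range (d), (Nat.choose (min 19 (5 + d) - 6) j : ℚ) / (((j + 1) + 3 * (j + 1).choose 2 : ℕ) : ℚ)) - (∑ j ∈ Finset.range (d), (Nat.choose (min 13 ((d + 6) / 2 + 1 - 2)) j : ℚ) / (((j + 1) + 3 * (j + 1).choose 2 : ℕ) : ℚ))) * ((min 19 (5 + d)).choose 6 : ℚ)) +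
      ((∑ j ∈ Finset.range (d + 1), (24 + d).choose j : ℕ) : ℚ)) ≤ (m : ℚ) * 2 ^ (24 + d)) := by
  interval_cases d
  · exact ⟨3, by norm_num, cellP24ST_poly_6, cellP24ST_tail_6⟩
  · exact ⟨3, by norm_num, cellP24ST_poly_7, cellP24ST_tail_7⟩
  · exact absurd rfl hd8
  · exact ⟨8, by norm_num, cellP24ST_poly_9, cellP24ST_tail_9⟩
  · exact ⟨13, by norm_num, cellP24ST_poly_10, cellP24ST_tail_10⟩
  · exact ⟨22, by norm_num, cellP24ST_poly_11, cellP24ST_tail_11⟩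
  · exact ⟨34, by norm_num, cellP24ST_poly_12, cellP24ST_tail_12⟩
  · exact ⟨51, by norm_num, cellP24ST_poly_13, cellP24ST_tail_13⟩
  · exact ⟨74, by norm_num, cellP24ST_poly_14, cellP24ST_tail_14⟩
  · exact ⟨103, by norm_num, cellP24ST_poly_15, cellP24ST_tail_15⟩
  · exact ⟨138, by norm_num, cellP24ST_poly_16, cellP24ST_tail_16⟩
  · exact ⟨179, by norm_num, cellP24ST_poly_17, cellP24ST_tail_17⟩
  · exact ⟨226, by norm_num, cellP24ST_poly_18, cellP24ST_tail_18⟩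
  · exact ⟨278, by norm_num, cellP24ST_poly_19, cellP24ST_tail_19⟩
  · exact ⟨334, by norm_num, cellP24ST_poly_20, cellP24ST_tail_20⟩
  · exact ⟨393, by norm_num, cellP24ST_poly_21, cellP24ST_tail_21⟩
  · exact ⟨453, by norm_num, cellP24ST_poly_22, cellP24ST_tail_22⟩
  · exact ⟨513, by norm_num, cellP24ST_poly_23, cellP24ST_tail_23⟩
  · exact ⟨571, by norm_num, cellP24ST_poly_24, cellP24ST_tail_24⟩
  · exact ⟨627, by norm_num, cellP24ST_poly_25, cellP24ST_tail_25⟩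

end S2

namespace ThmN

open Set

variable {α : Type}

/-- **The `e`-free core at level `5`, rank `24`, corank `8`**: the mid spanning sets number `≤ 91·C(12, 6)`
(S2MidFlatsEight), and the cell `(24, 8)` closes with the mid class explicit. -/
theorem c025_core_five_twentyfour_eight (M : Matroid α) [M.Finite]
    (hR : M.eRank = ((24 : ℕ) : ℕ∞)) (hn : M.E.ncard = 24 + 8)
    (hfree : ∀ e ∈ M.E, ∃ A ⊆ M.E \ {e}, e ∉ M.closure A ∧ e ∉ M.closure ((M.E \ {e}) \ A)) :
    RLS M 24 5 := by
  have hL0 : ∀ e ∈ M.E, ¬ M.IsLoop e := not_isLoop_of_free M hfree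
  have hd : M.E.encard = M.eRank + 8 := by
    rw [hR, ← M.ground_finite.cast_ncard_eq, hn]
    push_cast
    ring
  have hflat' : ∀ X ⊆ M.E, M.eRk X ≤ ((5 - 1 : ℕ) : ℕ∞) → X.ncard ≤ 10 := fun X hX hr =>
    ncard_le_ten_of_eRk_le_four_of_free M hfree hX (by simpa using hr)
  have hC2 : ∀ P ⊆ M.E, M.eRk P ≤ 3 → P.ncard ≤ 6 :=
    fun P hP hr => ncard_le_six_of_eRk_le_three_of_free M hfree hP hr
  have hC0 : ∀ X ⊆ M.E, M.eRk X ≤ 1 → X.ncard ≤ 1 := fun X hX hr => by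
    have := ncard_add_one_le_two_pow_of_eRk_le M hL0 hfree 1 X hX hr
    omega
  have hmid := S2.card_spanMid_le_eight hflat' hC2 hC0 hd
  have hmid' : (S2.spanMid M 5 (min 10 (4 + 8)) ((8 + 6) / 2 + 1)).card ≤ 91 * (12).choose 6 := by
    rw [show min 10 (4 + 8) = 10 by norm_num, show (8 + 6) / 2 + 1 = 8 by norm_num]
    exact hmid
  have key := c025_core_five_sharp_cell_mid M 24 8 (91 * (12).choose 6) (by norm_num) (by norm_num) hR hn hfree hmid'
  exact key S2.cellP24M

/-- **The `e`-free core at level `5`, rank `24`, every corank `6 ≤ d ≤ 25`**. -/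
theorem c025_core_five_twentyfour (M : Matroid α) [M.Finite] (d : ℕ) (hd6 : 6 ≤ d)
    (hd25 : d ≤ 25) (hR : M.eRank = ((24 : ℕ) : ℕ∞)) (hn : M.E.ncard = 24 + d)
    (hfree : ∀ e ∈ M.E, ∃ A ⊆ M.E \ {e}, e ∉ M.closure A ∧ e ∉ M.closure ((M.E \ {e}) \ A)) :
    RLS M 24 5 := by
  by_cases h8 : d = 8
  · subst h8
    exact c025_core_five_twentyfour_eight M hR hn hfree
  · exact c025_core_five_sharp_cell_st M 24 d hd6 hd25 hR hn hfree (S2.cellsP24ST d hd6 hd25 h8)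

/-- **THEOREM C₅, GIVEN LEVEL `4` FROM `P ≥ 24`**: level `4` for all `p ≥ P` implies level `5` for all `p ≥ P + 1`. -/
theorem c025_five_of_four_sharp_st_from (P : ℕ) (hP : 24 ≤ P)
    (h4 : ∀ (M : Matroid α) [M.Finite] (p : ℕ), P ≤ p → RLS M p 4) :
    ∀ (M : Matroid α) [M.Finite] (p : ℕ), P + 1 ≤ p → RLS M p 5 := by
  refine S2.rls_five_of_four_of_core P (by omega) h4 ?_
  intro M _ p hP' hR hbig hfree
  rcases Nat.lt_or_ge p 25 with h24 | h25
  · have hp' : p = 24 := by omega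
    subst hp'
    rcases Nat.lt_or_ge M.E.ncard (24 + 26) with h | h
    · exact c025_core_five_twentyfour M (M.E.ncard - 24) (by omega) (by omega) hR (by omega) hfree
    · exact c025_core_five_nineteen_at_twentyfour M (by omega) hfree
  · rcases Nat.lt_or_ge p 26 with h25' | h26
    · have hp' : p = 25 := by omega
      subst hp'
      rcases Nat.lt_or_ge M.E.ncard (25 + 26) with h | h
      · exact c025_core_five_twentyfive_cells M (M.E.ncard - 25) (by omega) (by omega) hR (by omega) hfree
      · exact c025_core_five_nineteen_at_twentyfive M (by omega) hfree
    · rcases Nat.lt_or_ge M.E.ncard (p + 26) with h | h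
      · exact c025_core_five_sharp_cells M p (M.E.ncard - p) h26 (by omega) (by omega) hR (by omega) hfree
      · rcases Nat.lt_or_ge p 27 with h27 | h27
        · have hp' : p = 26 := by omega
          subst hp'
          exact c025_core_five_nineteen_at_twentysix M (by omega) hfree
        · exact c025_core_five_nineteen M p h27 hR (by omega) hfree

/-- **THEOREM C₅ AT `25`, UNCONDITIONAL**: every finite matroid satisfies C-025 at level `5` for every `p ≥ 25` (level
`4` from S1's `c025_four_seventeen`). -/
theorem c025_five_large_sharp25 (M : Matroid α) [M.Finite] (p : ℕ) (hp : 25 ≤ p) : RLS M p 5 :=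
  c025_five_of_four_sharp_st_from 24 le_rfl (fun M _ p hp => S1.c025_four_seventeen M p (by omega)) M p hp

/-- The level-`5` statement at `p ≥ 25` in the vocabulary of `C025`. -/
theorem c025_five_large_sharp25' (M : Matroid α) [M.Finite] (p : ℕ) (hp : 25 ≤ p) :
    phiK p 5 * ({A : Set α | A ⊆ M.E ∧ M.eRk A = (p : ℕ∞) ∧ M.eRk (M.E \ A) = (5 : ℕ∞)}.ncard : ℚ) ≤
      ({A : Set α | A ⊆ M.E ∧ (5 : ℕ∞) < M.eRk A ∧ M.eRk A < (p : ℕ∞)}.ncard : ℚ) :=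
  c025_five_large_sharp25 M p hp

end ThmN

end PercRepro
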